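import Summits.ValiantsHypothesis.ValiantsHypothesis.Theorems.LacunarySymmetroidMatrixDescartesPivotTwoDirections

/-!
# `MatrixDescartes` census — pivot column at `m = 2`: the BLOCK `(2,2)` LAW in the interleaving chamber
# (a two-direction hard-cell `(2,4)` pencil has at most SIX positive roots where Descartes' rule allows EIGHT)

HONEST FRAMING.  Object-search cell `pub-symmetroid`, seat `val-sym-mdr-p1` (generation 12); helper file `--supports` the crux item
stmt-ValiantsHypothesis-18050 (`Theses.LacunarySymmetroid.MatrixDescartes`, OPEN, on HOLD) with NO closure claim.  Companion of
`…PivotTwoDirections` (two-direction pencils, `Z₊ ≤ 2·K_u·K_v`, block normal form) and `…PivotTwoDirectionsBlockSix` (a block with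
exactly `6`).  This file proves the first case of the BLOCK QUESTION recorded there that Descartes' rule does NOT give:

**THEOREM (`chamberI_posRoots_le_six`, real-parameter form `nineNomial_chamberI_le_six`).**  Let `F = X^e J + c₁X^{p₁}u uᵀ +
c₂X^{p₂}u uᵀ + c₃X^{q₁}v vᵀ + c₄X^{q₂}v vᵀ` be a `2 × 2` pencil with two `u`-letters BELOW the pivot (`p₂ < p₁ < e`, `c₁, c₂ > 0`), two
`v`-letters ABOVE it (`e < q₁ < q₂`, `c₄ > 0`, `c₃` arbitrary), `u` pairing negatively with `J` (`m(J,u) < 0`, the hard-cell sign) and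
`u, v` independent; `J` is otherwise ARBITRARY.  If the exponent gaps `aᵢ = e − pᵢ`, `bⱼ = qⱼ − e` lie in the INTERLEAVING CHAMBER
`b₁ < a₁`, `b₁ < a₂ − a₁`, `a₂ < b₂ < a₂ + b₁` — exactly where (in the hard cell) the nine coefficients of `det F` alternate
`− + − + − + − + −` and Descartes' bound is `8` — then `det F` has AT MOST SIX distinct positive roots.

PROOF (elementary, ≈ 300 lines).  (1) WEIGHTED ROLLE (`card_posRoots_le_kill`): for every `ρ : ℕ`,
`#Z₊(P) ≤ #Z₊(X·P′ − ρ·P) + 1` (Rolle / mean value for `P(x)/x^ρ` on `(0,∞)`; the degenerate case `X·P′ = ρ·P` is handled);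
`X·P′ − ρ·P` multiplies the coefficient of `Xⁿ` by `n − ρ` (`kill_monomial`, `kill_sum`), so killing the degrees of a list `L` costs
`|L|` roots (`card_posRoots_le_kills`).  (2) FOUR-NOMIAL LEMMA (`card_posRoots_fourNomial_le_one`): `A X^{n₀} − B X^{n₀+g} +
C X^{n₀+h} − D X^{n₀+g+h}` with `B, D > 0`, `B·C ≤ A·D`, `g ≥ 1` has at most ONE positive root (a root satisfies
`x^g = (A + Cx^h)/(B + Dx^h)`: increasing = non-increasing).  (3) `det F` is a nine-nomial (`det_block22`, from `det_twoDir`); kill the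
five degrees `2e, e+q₁, e+q₂, p₁+q₁, p₂+q₁`; the survivors sit at `e+p₂ < e+p₁ < p₂+q₂ < p₁+q₂` — two translated pairs, shift
`b₂`, offset `a₂ − a₁ < b₂` — with signs `+ − + −`, and the cross-ratio inequality `B·C ≤ A·D` reduces (the weights and `m(J,u)`,
`Δ²` cancel by the RANK-ONE structure of the letters) to the comparison of exponent-difference products
`(a₁+b₁)(a₁+b₂)(g−b₁)·(b₂−a₂)(a₂+b₁−b₂)(b₂−b₁−g) < (a₂+b₁)(a₂+b₂)(g+b₁)·(b₂−b₁−a₁)(b₂−a₁)(b₂−b₁+g)` (`g = a₂ − a₁`), true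
factor by factor in the chamber.  Hence `Z₊ ≤ 5 + 1 = 6`.

SCOPE / WHAT IS NOT HERE.  The mirror chamber II (`a₁ < b₁ < a₂ − a₁`, `max(a₂−a₁, a₁+b₁) < b₂ < a₂`) is the same argument with
the block `(α₂X^{−a₂} − 1)·G` (companion file to follow); in every other exponent configuration of a sign-separated `(2,2)` block the
sign word of the nine-nomial has at most `6` variations (it starts and ends with `−`, so `Var` is even, and `Var = 8` forces chamber I
or II — paper, this seat's memo BLOCKS.md), so Descartes' rule already gives `6` there; that bookkeeping is NOT formalised here.  The
bound `6 = 2K − 2` is attained (`…PivotTwoDirectionsBlockSix`).  Located support (exp/cover*.py): every `V = 8` sample of 392 547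
near-boundary chamber points satisfies the cross-ratio criterion with margin `≥ 38`.  Nothing here bears on `MatrixDescartes` in its
window, on `DoorA26` / `DoorA34`, registers / credences, or `VP ≠ VNP`.

[folklore] Rolle's theorem and the mean value theorem (Mathlib `exists_deriv_eq_zero`, `exists_hasDerivAt_eq_slope`,
`Finset.card_le_of_interleaved`, the pattern of Mathlib's `Polynomial.card_roots_toFinset_le_derivative`); the «kill a degree»
induction is the classical proof of Descartes' rule for fewnomials; presearch for the block law: Koiran–Portier–Tavenas,
arXiv:1310.2447 p. 3 (Li–Rojas–Wang `2^t − 2`, KPT `O(t³)` for trinomial × `t`-nomial systems — far above `6`); no source states this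
bound.  No definitions (the kill operator is written inline), no named facts.
-/

-- `Summit.ValiantsHypothesis.ValiantsHypothesis.…` repeats a component by the D-0017 layout
-- (single-conjunct summit), which the `dupNamespace` linter flags; the name is mandated.
set_option linter.dupNamespace false

namespace Summit.ValiantsHypothesis.ValiantsHypothesis.Theorems.LacunarySymmetroidMatrixDescartes.Pivot.TwoDirections.BlockLaw

open Polynomial Matrix Finset
open scoped BigOperators

/-! ## 1. The kill operator `X·P′ − ρ·P` and the weighted Rolle inequality -/

/-- `X·P′ − ρ·P` multiplies the coefficient of `Xⁿ` by `n − ρ` (so it kills degree `ρ`); we use it inline, no definition. -/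
theorem kill_monomial (ρ : ℕ) (c : ℝ) (n : ℕ) :
    (X : ℝ[X]) * derivative (Polynomial.C c * X ^ n) - Polynomial.C (ρ : ℝ) * (Polynomial.C c * X ^ n)
      = Polynomial.C (c * ((n : ℝ) - ρ)) * X ^ n := by
  rw [derivative_C_mul_X_pow]
  rcases Nat.eq_zero_or_pos n with h0 | hpos
  · subst h0
    simp only [Nat.cast_zero, mul_zero, map_zero, zero_mul, zero_sub, pow_zero, mul_one, map_mul, map_neg,
      map_natCast]
    ring
  · have e1 : (X : ℝ[X]) * (Polynomial.C (c * (n : ℝ)) * X ^ (n - 1)) = Polynomial.C (c * (n : ℝ)) * X ^ n := by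
      rw [mul_left_comm, ← pow_succ', Nat.sub_add_cancel hpos]
    rw [e1]
    simp only [map_mul, map_sub, map_natCast]
    ring

/-- The kill operator on a finite sum of monomials. [folklore] -/
theorem kill_sum {ι : Type*} (s : Finset ι) (ρ : ℕ) (c : ι → ℝ) (n : ι → ℕ) :
    (X : ℝ[X]) * derivative (∑ i ∈ s, Polynomial.C (c i) * X ^ n i)
        - Polynomial.C (ρ : ℝ) * (∑ i ∈ s, Polynomial.C (c i) * X ^ n i)
      = ∑ i ∈ s, Polynomial.C (c i * ((n i : ℝ) - ρ)) * X ^ n i := by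
  classical
  induction s using Finset.induction_on with
  | empty => simp
  | insert a s ha ih =>
    rw [Finset.sum_insert ha, Finset.sum_insert ha, derivative_add, ← ih, ← kill_monomial]
    ring

/-- **Weighted Rolle.**  The number of distinct positive roots of a real polynomial `P` is at most one more than that
of `X·P′ − ρ·P`, for every `ρ : ℕ` (Rolle / mean value theorem for `x ↦ P(x)/x^ρ` on `(0, ∞)`). [folklore] -/
theorem card_posRoots_le_kill (ρ : ℕ) (P : ℝ[X]) :
    (P.roots.toFinset.filter (fun t => 0 < t)).card
      ≤ (((X : ℝ[X]) * derivative P - Polynomial.C (ρ : ℝ) * P).roots.toFinset.filter (fun t => 0 < t)).card + 1 := by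
  classical
  set K : ℝ[X] := (X : ℝ[X]) * derivative P - Polynomial.C (ρ : ℝ) * P with hKdef
  by_cases hP : P = 0
  · subst hP; simp
  -- the function g(t) = P(t)/t^ρ and its derivative K(t)/t^(ρ+1) on (0, ∞)
  set g : ℝ → ℝ := fun t => P.eval t / t ^ ρ with hg
  have hK_eval : ∀ x, K.eval x = x * (derivative P).eval x - ρ * P.eval x := by
    intro x; simp [hKdef]
  have hderiv : ∀ z, 0 < z → HasDerivAt g (K.eval z / z ^ (ρ + 1)) z := by
    intro z hz0
    have hzne : z ^ ρ ≠ 0 := pow_ne_zero _ hz0.ne'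
    have hd := (P.hasDerivAt z).div (hasDerivAt_pow ρ z) hzne
    have e : ((derivative P).eval z * z ^ ρ - P.eval z * ((ρ : ℝ) * z ^ (ρ - 1))) / (z ^ ρ) ^ 2
        = K.eval z / z ^ (ρ + 1) := by
      rw [hK_eval, div_eq_div_iff (pow_ne_zero 2 hzne) (pow_ne_zero _ hz0.ne')]
      rcases Nat.eq_zero_or_pos ρ with h0 | hpos
      · subst h0; ring
      · have e1 : z ^ ρ = z * z ^ (ρ - 1) := by rw [← pow_succ', Nat.sub_add_cancel hpos]
        rw [pow_succ, e1]; ring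
    rw [e] at hd
    exact hd
  have hgcont : ∀ x y, 0 < x → ContinuousOn g (Set.Icc x y) := by
    intro x y hx0
    refine ContinuousOn.div P.continuousOn (continuousOn_pow ρ) fun t ht => ?_
    exact pow_ne_zero _ (ne_of_gt (lt_of_lt_of_le hx0 ht.1))
  by_cases hK : K = 0
  · -- then g is constant on (0,∞); a positive root of P would make P vanish on (0,∞), so P has no positive root
    have hconst : ∀ x y, 0 < x → x < y → g y = g x := by
      intro x y hx0 hxy
      obtain ⟨c, hc, hslope⟩ := exists_hasDerivAt_eq_slope g (fun z => K.eval z / z ^ (ρ + 1)) hxy (hgcont x y hx0)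
        (fun z hz => hderiv z (hx0.trans hz.1))
      rw [hK, eval_zero, zero_div] at hslope
      have h := hslope.symm
      rw [div_eq_zero_iff] at h
      rcases h with h | h
      · linarith
      · linarith [sub_pos.2 hxy]
    have hnoroot : (P.roots.toFinset.filter (fun t => 0 < t)) = ∅ := by
      by_contra hne
      obtain ⟨x₀, hx₀⟩ := Finset.nonempty_iff_ne_empty.2 hne
      rw [Finset.mem_filter, Multiset.mem_toFinset, mem_roots hP] at hx₀
      obtain ⟨hr, hx₀0⟩ := hx₀
      have hg0 : g x₀ = 0 := by simp only [hg]; rw [show P.eval x₀ = 0 from hr, zero_div]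
      -- P vanishes on (x₀, ∞)
      apply hP
      refine Polynomial.eq_zero_of_infinite_isRoot P (Set.infinite_of_not_bddAbove ?_)
      rintro ⟨M, hM⟩
      have hy : max M x₀ + 1 ∈ {x | P.IsRoot x} := by
        have hy0 : x₀ < max M x₀ + 1 := by linarith [le_max_right M x₀]
        have hgy : g (max M x₀ + 1) = 0 := by rw [hconst x₀ _ hx₀0 hy0, hg0]
        simp only [hg] at hgy
        rw [div_eq_zero_iff] at hgy
        rcases hgy with h | h
        · exact h
        · exact absurd h (pow_ne_zero _ (by linarith : max M x₀ + 1 ≠ 0))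
      have := hM hy
      linarith [le_max_left M x₀]
    rw [hnoroot]; simp
  -- K ≠ 0: Rolle between consecutive positive roots of P
  refine Finset.card_le_of_interleaved fun x hx y hy hxy _ => ?_
  rw [Finset.mem_filter, Multiset.mem_toFinset, mem_roots hP] at hx hy
  obtain ⟨hxr, hx0⟩ := hx
  obtain ⟨hyr, hy0⟩ := hy
  have hgxy : g x = g y := by
    simp only [hg]; rw [show P.eval x = 0 from hxr, show P.eval y = 0 from hyr, zero_div, zero_div]
  obtain ⟨z, hz, hz'⟩ := exists_deriv_eq_zero hxy (hgcont x y hx0) hgxy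
  have hz0 : 0 < z := hx0.trans hz.1
  have hval := (hderiv z hz0).deriv
  rw [hz'] at hval
  have hKz : K.eval z = 0 := by
    have h := hval.symm
    rw [div_eq_zero_iff] at h
    rcases h with h | h
    · exact h
    · exact absurd h (pow_ne_zero _ hz0.ne')
  refine ⟨z, ?_, hz.1, hz.2⟩
  rw [Finset.mem_filter, Multiset.mem_toFinset, mem_roots hK]
  exact ⟨hKz, hz0⟩


/-- **Iterated weighted Rolle on a fewnomial.**  Killing the degrees of a list `L` one after the other multiplies the
coefficient of `X^{nᵢ}` by `∏_{ρ ∈ L} (nᵢ − ρ)` and costs at most one positive root per step. [folklore] -/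
theorem card_posRoots_le_kills {ι : Type*} (s : Finset ι) (n : ι → ℕ) (L : List ℕ) (c : ι → ℝ) :
    ((∑ i ∈ s, Polynomial.C (c i) * X ^ n i).roots.toFinset.filter (fun t => 0 < t)).card
      ≤ ((∑ i ∈ s, Polynomial.C (c i * (L.map (fun ρ : ℕ => ((n i : ℝ) - (ρ : ℝ)))).prod) * X ^ n i).roots.toFinset.filter
          (fun t => 0 < t)).card + L.length := by
  induction L generalizing c with
  | nil => simp
  | cons ρ L ih =>
    have h1 := card_posRoots_le_kill ρ (∑ i ∈ s, Polynomial.C (c i) * X ^ n i)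
    rw [kill_sum] at h1
    have h2 := ih (fun i => c i * ((n i : ℝ) - ρ))
    simp only [List.map_cons, List.prod_cons, List.length_cons, ← mul_assoc] at h2 ⊢
    omega

/-! ## 2. A four-nomial with two interleaved translated pairs and a small cross ratio has at most ONE positive root -/

/-- **Four-nomial lemma.**  For reals `A, C` and `B, D > 0` with `B·C ≤ A·D` and `g ≥ 1`, the polynomial
`A X^{n₀} − B X^{n₀+g} + C X^{n₀+h} − D X^{n₀+g+h}` has at most one positive root: a positive root satisfies
`x^g = (A + C x^h)/(B + D x^h)`, whose left side is strictly increasing and right side non-increasing in `x`. [folklore] -/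
theorem card_posRoots_fourNomial_le_one (A B C D : ℝ) (hB : 0 < B) (hD : 0 < D)
    (hBC : B * C ≤ A * D) (n₀ g h : ℕ) (hg : 1 ≤ g) :
    ((Polynomial.C A * X ^ n₀ - Polynomial.C B * X ^ (n₀ + g) + Polynomial.C C * X ^ (n₀ + h)
        - Polynomial.C D * X ^ (n₀ + g + h)).roots.toFinset.filter (fun t => 0 < t)).card ≤ 1 := by
  classical
  set Q := Polynomial.C A * X ^ n₀ - Polynomial.C B * X ^ (n₀ + g) + Polynomial.C C * X ^ (n₀ + h)
        - Polynomial.C D * X ^ (n₀ + g + h) with hQ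
  -- a positive root satisfies x^g (B + D x^h) = A + C x^h
  have key : ∀ x : ℝ, 0 < x → Q.eval x = 0 → x ^ g * (B + D * x ^ h) = A + C * x ^ h := by
    intro x hx hx0
    have hev : Q.eval x = x ^ n₀ * ((A + C * x ^ h) - x ^ g * (B + D * x ^ h)) := by
      simp only [hQ, eval_sub, eval_add, eval_mul, eval_C, eval_pow, eval_X, pow_add]
      ring
    rw [hev] at hx0
    rcases mul_eq_zero.1 hx0 with h0 | h0
    · exact absurd h0 (pow_ne_zero _ hx.ne')
    · linarith
  -- two positive roots x < y are impossible
  have mono : ∀ x y : ℝ, 0 < x → x < y → Q.eval x = 0 → Q.eval y = 0 → False := by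
    intro x y hx hxy hx0 hy0
    have hy : 0 < y := hx.trans hxy
    have ex := key x hx hx0
    have ey := key y hy hy0
    have hxh : x ^ h ≤ y ^ h := pow_le_pow_left₀ hx.le hxy.le h
    have hxg : x ^ g < y ^ g := pow_lt_pow_left₀ hxy hx.le (by omega)
    -- (A + C x^h)(B + D y^h) ≥ (A + C y^h)(B + D x^h)
    have cmp : (A + C * y ^ h) * (B + D * x ^ h) ≤ (A + C * x ^ h) * (B + D * y ^ h) := by
      nlinarith [mul_nonneg (sub_nonneg.2 hBC) (sub_nonneg.2 hxh)]
    rw [← ex, ← ey] at cmp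
    -- so y^g · P ≤ x^g · P with P = (B + D x^h)(B + D y^h) > 0
    have hPx : 0 < B + D * x ^ h := by positivity
    have hPy : 0 < B + D * y ^ h := by positivity
    have : y ^ g * ((B + D * y ^ h) * (B + D * x ^ h)) ≤ x ^ g * ((B + D * x ^ h) * (B + D * y ^ h)) := by
      nlinarith [cmp]
    have hP : 0 < (B + D * x ^ h) * (B + D * y ^ h) := mul_pos hPx hPy
    nlinarith [mul_lt_mul_of_pos_right hxg hP]
  by_cases hQ0 : Q = 0
  · rw [hQ0]; simp
  refine Finset.card_le_one.2 fun x hx y hy => ?_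
  rw [Finset.mem_filter, Multiset.mem_toFinset, mem_roots hQ0] at hx hy
  rcases lt_trichotomy x y with hlt | heq | hgt
  · exact (mono x y hx.2 hlt hx.1 hy.1).elim
  · exact heq
  · exact (mono y x hy.2 hgt hy.1 hx.1).elim


/-! ## 3. The sign-separated `(2,2)` block in the INTERLEAVING CHAMBER I: `Z₊ ≤ 6` (Descartes allows `8`) -/

/-- The nine-term expansion of the determinant of a sign-separated `(2,2)` two-direction pencil
(`u`-letters `c₁, c₂` at exponents `p₁, p₂`, `v`-letters `c₃, c₄` at `q₁, q₂`, pivot `J` at `e`). [folklore] -/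
theorem det_block22 (e p₁ p₂ q₁ q₂ : ℕ) (J : Matrix (Fin 2) (Fin 2) ℝ) (u v : Fin 2 → ℝ) (c₁ c₂ c₃ c₄ : ℝ) :
    Matrix.det (((X : ℝ[X]) ^ e) • J.map Polynomial.C
        + (Polynomial.C c₁ * X ^ p₁ + Polynomial.C c₂ * X ^ p₂) • (vecMulVec u u).map Polynomial.C
        + (Polynomial.C c₃ * X ^ q₁ + Polynomial.C c₄ * X ^ q₂) • (vecMulVec v v).map Polynomial.C)
      = ∑ i : Fin 9, Polynomial.C ((![J.det,
            c₁ * (J 0 0 * u 1 ^ 2 + J 1 1 * u 0 ^ 2 - (J 0 1 + J 1 0) * (u 0 * u 1)),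
            c₂ * (J 0 0 * u 1 ^ 2 + J 1 1 * u 0 ^ 2 - (J 0 1 + J 1 0) * (u 0 * u 1)),
            c₃ * (J 0 0 * v 1 ^ 2 + J 1 1 * v 0 ^ 2 - (J 0 1 + J 1 0) * (v 0 * v 1)),
            c₄ * (J 0 0 * v 1 ^ 2 + J 1 1 * v 0 ^ 2 - (J 0 1 + J 1 0) * (v 0 * v 1)),
            c₁ * c₃ * (u 0 * v 1 - u 1 * v 0) ^ 2, c₂ * c₃ * (u 0 * v 1 - u 1 * v 0) ^ 2,
            c₁ * c₄ * (u 0 * v 1 - u 1 * v 0) ^ 2, c₂ * c₄ * (u 0 * v 1 - u 1 * v 0) ^ 2] : Fin 9 → ℝ) i)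
          * X ^ ((![2 * e, e + p₁, e + p₂, e + q₁, e + q₂, p₁ + q₁, p₂ + q₁, p₁ + q₂, p₂ + q₂] : Fin 9 → ℕ) i) := by
  rw [det_twoDir]
  simp only [Fin.sum_univ_succ, Fin.sum_univ_zero, Matrix.cons_val_zero, Matrix.cons_val_succ, map_mul, map_sub,
    map_add, map_pow]
  simp
  ring

/-- **The nine-nomial of chamber I has at most six positive roots** (real-parameter form of the block law: `mu < 0` is the
pairing of the `u`-direction with the pivot, `Δ2 > 0` the squared direction discriminant, `dJ`, `mv`, `c₃` arbitrary). -/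
theorem nineNomial_chamberI_le_six (e p₁ p₂ q₁ q₂ : ℕ) (h21 : p₂ < p₁) (h1e : p₁ < e) (he1 : e < q₁) (h12 : q₁ < q₂)
    (hI1 : q₁ + p₁ < 2 * e) (hI2 : q₁ + p₂ < e + p₁) (hI3 : 2 * e < q₂ + p₂) (hI4 : q₂ + p₂ < q₁ + e)
    (dJ mu mv Δ2 c₁ c₂ c₃ c₄ : ℝ) (hc₁ : 0 < c₁) (hc₂ : 0 < c₂) (hc₄ : 0 < c₄) (hmu : mu < 0) (hΔ2p : 0 < Δ2) :
    ((∑ i : Fin 9, Polynomial.C ((![dJ, c₁ * mu, c₂ * mu, c₃ * mv, c₄ * mv, c₁ * c₃ * Δ2, c₂ * c₃ * Δ2, c₁ * c₄ * Δ2, c₂ * c₄ * Δ2] : Fin 9 → ℝ) i) * X ^ ((![2 * e, e + p₁, e + p₂, e + q₁, e + q₂, p₁ + q₁, p₂ + q₁, p₁ + q₂, p₂ + q₂] : Fin 9 → ℕ) i)).roots.toFinset.filter (fun t => 0 < t)).card ≤ 6 := by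
  classical
  -- real casts of the exponent inequalities
  have hp21 : (p₂ : ℝ) < p₁ := by exact_mod_cast h21
  have hp1e : (p₁ : ℝ) < e := by exact_mod_cast h1e
  have heq1 : (e : ℝ) < q₁ := by exact_mod_cast he1
  have hq12 : (q₁ : ℝ) < q₂ := by exact_mod_cast h12
  have hI1' : (q₁ : ℝ) + p₁ < 2 * e := by exact_mod_cast hI1
  have hI2' : (q₁ : ℝ) + p₂ < e + p₁ := by exact_mod_cast hI2
  have hI3' : 2 * (e : ℝ) < q₂ + p₂ := by exact_mod_cast hI3
  have hI4' : (q₂ : ℝ) + p₂ < q₁ + e := by exact_mod_cast hI4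
  have hnmu : 0 < -mu := by linarith
  -- the linear factors (opaque atoms with defining equations)
  obtain ⟨a1, ha1⟩ : ∃ x : ℝ, x = (e : ℝ) - p₁ := ⟨_, rfl⟩
  obtain ⟨a2, ha2⟩ : ∃ x : ℝ, x = (e : ℝ) - p₂ := ⟨_, rfl⟩
  obtain ⟨b1, hb1⟩ : ∃ x : ℝ, x = (q₁ : ℝ) - e := ⟨_, rfl⟩
  obtain ⟨H, hH⟩ : ∃ x : ℝ, x = (q₂ : ℝ) - q₁ := ⟨_, rfl⟩
  obtain ⟨R1, hR1⟩ : ∃ x : ℝ, x = (q₁ : ℝ) - p₁ := ⟨_, rfl⟩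
  obtain ⟨R2, hR2⟩ : ∃ x : ℝ, x = (q₂ : ℝ) - p₁ := ⟨_, rfl⟩
  obtain ⟨R3, hR3⟩ : ∃ x : ℝ, x = (e : ℝ) + p₁ - p₂ - q₁ := ⟨_, rfl⟩
  obtain ⟨R4, hR4⟩ : ∃ x : ℝ, x = (p₂ : ℝ) + q₂ - 2 * e := ⟨_, rfl⟩
  obtain ⟨R5, hR5⟩ : ∃ x : ℝ, x = (e : ℝ) + q₁ - p₂ - q₂ := ⟨_, rfl⟩
  obtain ⟨R6, hR6⟩ : ∃ x : ℝ, x = (q₂ : ℝ) - q₁ - p₁ + p₂ := ⟨_, rfl⟩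
  obtain ⟨L1, hL1⟩ : ∃ x : ℝ, x = (q₁ : ℝ) - p₂ := ⟨_, rfl⟩
  obtain ⟨L2, hL2⟩ : ∃ x : ℝ, x = (q₂ : ℝ) - p₂ := ⟨_, rfl⟩
  obtain ⟨L3, hL3⟩ : ∃ x : ℝ, x = (p₁ : ℝ) + q₁ - e - p₂ := ⟨_, rfl⟩
  obtain ⟨L4, hL4⟩ : ∃ x : ℝ, x = (q₂ : ℝ) - q₁ - e + p₁ := ⟨_, rfl⟩
  obtain ⟨L5, hL5⟩ : ∃ x : ℝ, x = (p₁ : ℝ) + q₂ - 2 * e := ⟨_, rfl⟩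
  obtain ⟨L6, hL6⟩ : ∃ x : ℝ, x = (q₂ : ℝ) - q₁ + p₁ - p₂ := ⟨_, rfl⟩
  have ha1p : 0 < a1 := by rw [ha1]; linarith
  have ha2p : 0 < a2 := by rw [ha2]; linarith
  have hb1p : 0 < b1 := by rw [hb1]; linarith
  have hHp : 0 < H := by rw [hH]; linarith
  have hR1p : 0 < R1 := by rw [hR1]; linarith
  have hR2p : 0 < R2 := by rw [hR2]; linarith
  have hR3p : 0 < R3 := by rw [hR3]; linarith
  have hR4p : 0 < R4 := by rw [hR4]; linarith
  have hR5p : 0 < R5 := by rw [hR5]; linarith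
  have hR6p : 0 < R6 := by rw [hR6]; linarith
  have f1 : R1 < L1 := by rw [hR1, hL1]; linarith
  have f2 : R2 < L2 := by rw [hR2, hL2]; linarith
  have f3 : R3 < L3 := by rw [hR3, hL3]; linarith
  have f4 : R4 < L4 := by rw [hR4, hL4]; linarith
  have f5 : R5 < L5 := by rw [hR5, hL5]; linarith
  have f6 : R6 < L6 := by rw [hR6, hL6]; linarith
  have hL4p : 0 < L4 := hR4p.trans f4
  have hL5p : 0 < L5 := hR5p.trans f5
  have hL6p : 0 < L6 := hR6p.trans f6
  -- the four surviving coefficients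
  obtain ⟨A, hA⟩ : ∃ x : ℝ, x = c₂ * (-mu) * (a2 * b1) * (L1 * L2 * L3) := ⟨_, rfl⟩
  obtain ⟨B, hB⟩ : ∃ x : ℝ, x = c₁ * (-mu) * (a1 * b1) * (R1 * R2 * R3) := ⟨_, rfl⟩
  obtain ⟨C, hC⟩ : ∃ x : ℝ, x = c₂ * c₄ * Δ2 * (a2 * H) * (R4 * R5 * R6) := ⟨_, rfl⟩
  obtain ⟨D, hD⟩ : ∃ x : ℝ, x = c₁ * c₄ * Δ2 * (a1 * H) * (L4 * L5 * L6) := ⟨_, rfl⟩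
  have hBp : 0 < B := by
    rw [hB]
    exact mul_pos (mul_pos (mul_pos hc₁ hnmu) (mul_pos ha1p hb1p)) (mul_pos (mul_pos hR1p hR2p) hR3p)
  have hDp : 0 < D := by
    rw [hD]
    exact mul_pos (mul_pos (mul_pos (mul_pos hc₁ hc₄) hΔ2p) (mul_pos ha1p hHp)) (mul_pos (mul_pos hL4p hL5p) hL6p)
  -- the cross-ratio inequality B·C ≤ A·D (factor pairing Rₖ < Lₖ)
  have hBC : B * C ≤ A * D := by
    have key : R1 * R2 * R3 * (R4 * R5 * R6) < L1 * L2 * L3 * (L4 * L5 * L6) := by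
      have m2 := mul_lt_mul'' f1 f2 hR1p.le hR2p.le
      have m3 := mul_lt_mul'' m2 f3 (mul_pos hR1p hR2p).le hR3p.le
      have n2 := mul_lt_mul'' f4 f5 hR4p.le hR5p.le
      have n3 := mul_lt_mul'' n2 f6 (mul_pos hR4p hR5p).le hR6p.le
      exact mul_lt_mul'' m3 n3 (mul_pos (mul_pos hR1p hR2p) hR3p).le (mul_pos (mul_pos hR4p hR5p) hR6p).le
    have common : 0 < c₁ * c₂ * c₄ * Δ2 * (-mu) * (a1 * a2 * b1 * H) :=
      mul_pos (mul_pos (mul_pos (mul_pos (mul_pos hc₁ hc₂) hc₄) hΔ2p) hnmu)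
        (mul_pos (mul_pos (mul_pos ha1p ha2p) hb1p) hHp)
    have eBC : B * C = c₁ * c₂ * c₄ * Δ2 * (-mu) * (a1 * a2 * b1 * H) * (R1 * R2 * R3 * (R4 * R5 * R6)) := by
      rw [hB, hC]; ring
    have eAD : A * D = c₁ * c₂ * c₄ * Δ2 * (-mu) * (a1 * a2 * b1 * H) * (L1 * L2 * L3 * (L4 * L5 * L6)) := by
      rw [hA, hD]; ring
    rw [eBC, eAD]
    exact mul_le_mul_of_nonneg_left key.le common.le
  -- five kills
  have hkills := card_posRoots_le_kills (Finset.univ : Finset (Fin 9)) (![2 * e, e + p₁, e + p₂, e + q₁, e + q₂, p₁ + q₁, p₂ + q₁, p₁ + q₂, p₂ + q₂] : Fin 9 → ℕ) [2 * e, e + q₁, e + q₂, p₁ + q₁, p₂ + q₁] (![dJ, c₁ * mu, c₂ * mu, c₃ * mv, c₄ * mv, c₁ * c₃ * Δ2, c₂ * c₃ * Δ2, c₁ * c₄ * Δ2, c₂ * c₄ * Δ2] : Fin 9 → ℝ)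
  -- the killed nine-nomial IS the four-nomial `A X^{e+p₂} − B X^{e+p₁} + C X^{p₂+q₂} − D X^{p₁+q₂}`
  have hfour : (∑ i ∈ (Finset.univ : Finset (Fin 9)), Polynomial.C ((![dJ, c₁ * mu, c₂ * mu, c₃ * mv, c₄ * mv, c₁ * c₃ * Δ2, c₂ * c₃ * Δ2, c₁ * c₄ * Δ2, c₂ * c₄ * Δ2] : Fin 9 → ℝ) i
          * (([2 * e, e + q₁, e + q₂, p₁ + q₁, p₂ + q₁]).map (fun ρ : ℕ => ((((![2 * e, e + p₁, e + p₂, e + q₁, e + q₂, p₁ + q₁, p₂ + q₁, p₁ + q₂, p₂ + q₂] : Fin 9 → ℕ) i : ℕ) : ℝ) - (ρ : ℝ)))).prod) * X ^ ((![2 * e, e + p₁, e + p₂, e + q₁, e + q₂, p₁ + q₁, p₂ + q₁, p₁ + q₂, p₂ + q₂] : Fin 9 → ℕ) i))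
      = Polynomial.C A * X ^ (e + p₂) - Polynomial.C B * X ^ (e + p₂ + (p₁ - p₂))
          + Polynomial.C C * X ^ (e + p₂ + (q₂ - e)) - Polynomial.C D * X ^ (e + p₂ + (p₁ - p₂) + (q₂ - e)) := by
    have e1 : e + p₂ + (p₁ - p₂) = e + p₁ := by omega
    have e2 : e + p₂ + (q₂ - e) = p₂ + q₂ := by omega
    have e3 : e + p₂ + (p₁ - p₂) + (q₂ - e) = p₁ + q₂ := by omega
    rw [e3, e1, e2]
    -- coefficientwise: the killed nine coefficients are (0, −B, A, 0, 0, 0, 0, −D, C)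
    have hcoef : ∀ i : Fin 9, (![dJ, c₁ * mu, c₂ * mu, c₃ * mv, c₄ * mv, c₁ * c₃ * Δ2, c₂ * c₃ * Δ2, c₁ * c₄ * Δ2, c₂ * c₄ * Δ2] : Fin 9 → ℝ) i * (([2 * e, e + q₁, e + q₂, p₁ + q₁, p₂ + q₁]).map (fun ρ : ℕ => ((((![2 * e, e + p₁, e + p₂, e + q₁, e + q₂, p₁ + q₁, p₂ + q₁, p₁ + q₂, p₂ + q₂] : Fin 9 → ℕ) i : ℕ) : ℝ) - (ρ : ℝ)))).prod
        = (![0, -B, A, 0, 0, 0, 0, -D, C] : Fin 9 → ℝ) i := by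
      intro i
      fin_cases i <;>
        simp only [Fin.zero_eta, Fin.mk_one, Fin.isValue, Matrix.cons_val_zero, Matrix.cons_val_one,
          List.map_cons, List.map_nil, List.prod_cons, List.prod_nil, hA, hB, hC, hD, ha1, ha2, hb1, hH, hR1, hR2, hR3,
          hR4, hR5, hR6, hL1, hL2, hL3, hL4, hL5, hL6] <;>
        push_cast <;> ring
    rw [Finset.sum_congr rfl (fun i _ => by rw [hcoef i])]
    simp only [Fin.sum_univ_succ, Fin.sum_univ_zero, Matrix.cons_val_zero, Matrix.cons_val_succ, map_zero, zero_mul,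
      zero_add, add_zero, Polynomial.C_neg]
    ring
  rw [hfour] at hkills
  have hone := card_posRoots_fourNomial_le_one A B C D hBp hDp hBC (e + p₂) (p₁ - p₂) (q₂ - e) (by omega)
  simp only [List.length_cons, List.length_nil] at hkills
  omega

/-- **BLOCK `(2,2)` LAW, CHAMBER I.**  A sign-separated `(2,2)` two-direction pencil — `u`-letters (weights `c₁, c₂ > 0`)
at exponents `p₂ < p₁` BELOW the pivot exponent `e`, `v`-letters (weights `c₃`, `c₄ > 0`) at `q₁ < q₂` ABOVE it, `u` pairing
negatively with the pivot (`m(J,u) < 0`), directions independent — whose exponents lie in the INTERLEAVING CHAMBER I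
(`b₁ < a₁`, `b₁ < a₂ − a₁`, `a₂ < b₂ < a₂ + b₁` for `aᵢ = e − pᵢ`, `bⱼ = qⱼ − e`; in the hard cell the determinant's nine
coefficients then alternate perfectly and Descartes' rule allows EIGHT positive roots) has AT MOST SIX positive determinant
roots.  Proof: kill the five degrees `2e, e+q₁, e+q₂, p₁+q₁, p₂+q₁` (weighted Rolle, `card_posRoots_le_kills`); the surviving
four-nomial (degrees `e+p₂ < e+p₁ < p₂+q₂ < p₁+q₂`, signs `+ − + −`) has cross ratio `< 1` by a factor-by-factor comparison of
exponent differences, so it has at most ONE positive root (`card_posRoots_fourNomial_le_one`).  `J` is otherwise arbitrary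
(`det J`, `m(J,v)` and `c₃` only enter killed terms). [this file] -/
theorem chamberI_posRoots_le_six (e p₁ p₂ q₁ q₂ : ℕ) (h21 : p₂ < p₁) (h1e : p₁ < e) (he1 : e < q₁) (h12 : q₁ < q₂)
    (hI1 : q₁ + p₁ < 2 * e) (hI2 : q₁ + p₂ < e + p₁) (hI3 : 2 * e < q₂ + p₂) (hI4 : q₂ + p₂ < q₁ + e)
    (J : Matrix (Fin 2) (Fin 2) ℝ) (u v : Fin 2 → ℝ) (c₁ c₂ c₃ c₄ : ℝ) (hc₁ : 0 < c₁) (hc₂ : 0 < c₂) (hc₄ : 0 < c₄)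
    (hmu : J 0 0 * u 1 ^ 2 + J 1 1 * u 0 ^ 2 - (J 0 1 + J 1 0) * (u 0 * u 1) < 0) (hΔ : u 0 * v 1 - u 1 * v 0 ≠ 0) :
    ((Matrix.det (((X : ℝ[X]) ^ e) • J.map Polynomial.C
        + (Polynomial.C c₁ * X ^ p₁ + Polynomial.C c₂ * X ^ p₂) • (vecMulVec u u).map Polynomial.C
        + (Polynomial.C c₃ * X ^ q₁ + Polynomial.C c₄ * X ^ q₂) • (vecMulVec v v).map Polynomial.C)).roots.toFinset.filter
        (fun t => 0 < t)).card ≤ 6 := by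
  rw [det_block22]
  exact nineNomial_chamberI_le_six e p₁ p₂ q₁ q₂ h21 h1e he1 h12 hI1 hI2 hI3 hI4 J.det _ _ _ c₁ c₂ c₃ c₄ hc₁ hc₂ hc₄ hmu
    (by positivity)

end Summit.ValiantsHypothesis.ValiantsHypothesis.Theorems.LacunarySymmetroidMatrixDescartes.Pivot.TwoDirections.BlockLaw
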